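import Summits.QuantumFields.BalabanUV.T4Continuum.Support.NE3EnergyPathC2Velocity
import Summits.QuantumFields.BalabanUV.T4Continuum.Support.AveragingDeficitBlockDensity
import Literature.MathematicalPhysics.QuantumFieldTheory.Balaban1983to89.BlockAveragingExpMeanLog
import HarnessLib

/-!
# T⁴ programme, node NE3 — route Π, THE PRODUCT PATH `t ↦ W·e^{(1−t)²N}·e^{−(1−t)X}`: exact right-logarithmic velocity
# and acceleration (no Duhamel integral), log-coordinates, and the elementary bounds

NE3 (node U1b), row NE3 OWNER `b2b-balaban-t4-ne3-p1` (gen 24); design note `D-ne3p1-g24-1.md` §3 (ruling ρ-g24-2).  The chart of the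
local half of NE3 needs a bondwise-C² path of configurations from `U_A^u = W·e^{N}·e^{−X}` (tangent datum `X`, normal part `N`) to `W`.
Instead of the additive polynomial path `(1−t)·Y♯ + (1−t)²·N♯` (whose right-logarithmic velocity is a Duhamel integral) THIS FILE uses the
PRODUCT of two one-parameter subgroups, bond by bond:

  `P t b = exp((1−t)²·N b) · exp((t−1)·X b)`,   `P 0 = e^{N}e^{−X}`, `P 1 = 1`,

whose velocity `Ψ` (`P′ = P·Ψ`) and acceleration `Ψ′` are EXPLICIT:

  `Ψ t = X − 2(1−t)·C t`,  `Ψ′ t = 2·C t + 2(1−t)·[X, C t]`,  `C t b := e^{(1−t)X b}·N b·e^{(t−1)X b}` (= `Ad_{e^{(1−t)X}} N`),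

so `Ψ 1 = X` exactly and every deviation term carries the normal part `N` (conjugated by a unitary).  The log-coordinates
`Γ t b := skewHalf (mlog (P t b))` are skew at every time, vanish at `t = 1`, and satisfy `exp (Γ t b) = P t b` near `[0,1]` under the sup
smallness `‖X b‖ ≤ 1∕16`, `‖N b‖ ≤ 1∕32`.

CONTENT ([folklore]; matrix calculus, 0 sorry): §1 `conjN`, `vel`, `acc`, `prodM` and the EXACT derivative formulas `hasDerivAt_prodM`,
`hasDerivAt_vel`, `vel_one`, `prodM_one`, `prodM_zero`; §2 skewness of `C t`, `Ψ t`, `Ψ′ t`; norm facts `norm_conjN_eq`-type bounds;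
§3 `skewHalf`, `pathΓ`, `norm_prodM_sub_one_le`, `exp_pathΓ` (near `[0,1]`), `pathΓ_one`, `isSkewDir_pathΓ`, periodicity, and the
velocity∕acceleration fields of the chart: `hasDerivAt_exp_pathΓ` (`vel`), `hasDerivAt_vel'` (`acc`) on `[0,1]`.

HONEST FRAMING.  Exact identities + elementary norm bounds; nothing about Bałaban's minimisers; NE3 NOT proved; spine PROVED 0∕9; finite
T⁴ rung (B)+1 — NOT infinite volume, NOT mass gap, NOT `BetaPertH`, NOT Clay.  ABSOLUTE RULE kept.  PLACEMENT: `Summits/QuantumFields/BalabanUV/`.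
HONEST DEPENDENCY: continuum YM on T⁴ ⇐ BetaPertH ∧ nine spine estimates (0/9 proved); BetaPertH ⇐ (D1) ∧ (D4) ∧ CAP+tail; G-an2-4 gates
asym, D1 and NE2/3/4.
-/

set_option autoImplicit false

open scoped BigOperators Matrix.Norms.L2Operator Topology
open NormedSpace Finset Filter

namespace Summit.QuantumFields.BalabanUV.T4Continuum.NE3ProductPath

open Set
open Literature.MathematicalPhysics.QuantumFieldTheory.Balaban1983to89
open B7Prop1Explicit B7Prop2Explicit MatrixLog
open T4AveragingDeficitWall (IsSkewDir vary)
open AveragingDeficitPeriodicCounting (IsPeriodicDir)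
open NE3EnergyPathC2 (exp_neg_mul_exp_eq_one exp_mul_exp_neg_eq_one)
open NE3EnergyPathC2Velocity (rvel_of_smul)
open AveragingDeficitBlockDensity (norm_exp_sub_one_le_two_mul)

noncomputable section

variable {d : ℕ} {n : Type*} [Fintype n] [DecidableEq n]

/-! ## §1 The product path of one bond and its exact velocity and acceleration -/

/-- Real scalar action through `ℂ` (the package's convention). -/
local notation "r•" c:max => (((c : ℝ) : ℂ) • ·)

/-- `E_N t A := exp((1−t)²·A)`. [folklore] -/
def expN (t : ℝ) (A : Matrix n n ℂ) : Matrix n n ℂ := exp ((((1 - t) ^ 2 : ℝ) : ℂ) • A)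

/-- `E_X t A := exp((t−1)·A)` (so `E_X 1 = 1`, `E_X 0 = e^{−A}`). [folklore] -/
def expX (t : ℝ) (A : Matrix n n ℂ) : Matrix n n ℂ := exp ((((t - 1) : ℝ) : ℂ) • A)

/-- THE PRODUCT PATH OF ONE BOND: `P t = e^{(1−t)²N}·e^{(t−1)X}`. [folklore] -/
def prodM (X N : Matrix n n ℂ) (t : ℝ) : Matrix n n ℂ := expN t N * expX t X

/-- THE CONJUGATED NORMAL PART `C t = e^{(1−t)X}·N·e^{(t−1)X}`. [folklore] -/
def conjN (X N : Matrix n n ℂ) (t : ℝ) : Matrix n n ℂ :=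
  exp ((((1 - t) : ℝ) : ℂ) • X) * N * exp ((((t - 1) : ℝ) : ℂ) • X)

/-- THE RIGHT-LOGARITHMIC VELOCITY `Ψ t = X − 2(1−t)·C t`. [folklore] -/
def vel (X N : Matrix n n ℂ) (t : ℝ) : Matrix n n ℂ := X + (((-2 * (1 - t)) : ℝ) : ℂ) • conjN X N t

/-- THE ACCELERATION `Ψ′ t = 2·C t + 2(1−t)·(X·C t − C t·X)`. [folklore] -/
def acc (X N : Matrix n n ℂ) (t : ℝ) : Matrix n n ℂ :=
  ((2 : ℝ) : ℂ) • conjN X N t + (((2 * (1 - t)) : ℝ) : ℂ) • (X * conjN X N t - conjN X N t * X)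

/-- `P 1 = 1`. [folklore] -/
theorem prodM_one (X N : Matrix n n ℂ) : prodM X N 1 = 1 := by
  simp [prodM, expN, expX]

/-- `P 0 = e^{N}·e^{−X}`. [folklore] -/
theorem prodM_zero (X N : Matrix n n ℂ) : prodM X N 0 = exp N * exp (-X) := by
  simp only [prodM, expN, expX, sub_zero, one_pow, zero_sub]
  congr 1
  · simp
  · rw [show (((-1 : ℝ)) : ℂ) = -1 by norm_num, neg_one_smul]

/-- `Ψ 1 = X`: the tangent datum is the end velocity. [folklore] -/
theorem vel_one (X N : Matrix n n ℂ) : vel X N 1 = X := by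
  simp [vel]

/-- `e^{(t−1)X}·e^{(1−t)X} = 1`. [folklore] -/
theorem expX_mul_exp_one_sub (t : ℝ) (A : Matrix n n ℂ) :
    expX t A * exp ((((1 - t) : ℝ) : ℂ) • A) = 1 := by
  have h : ((((1 - t) : ℝ) : ℂ) • A) = -(((((t - 1) : ℝ) : ℂ) • A)) := by
    rw [← neg_smul]; congr 1; push_cast; ring
  rw [expX, h]
  exact exp_mul_exp_neg_eq_one _

/-- `e^{(1−t)X}·e^{(t−1)X} = 1`. [folklore] -/
theorem exp_one_sub_mul_expX (t : ℝ) (A : Matrix n n ℂ) :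
    exp ((((1 - t) : ℝ) : ℂ) • A) * expX t A = 1 := by
  have h : ((((1 - t) : ℝ) : ℂ) • A) = -(((((t - 1) : ℝ) : ℂ) • A)) := by
    rw [← neg_smul]; congr 1; push_cast; ring
  rw [expX, h]
  exact exp_neg_mul_exp_eq_one _

/-- **THE VELOCITY FORMULA**: `d∕dt P t = P t · Ψ t` at every `t`. [folklore] -/
theorem hasDerivAt_prodM (X N : Matrix n n ℂ) (t : ℝ) :
    HasDerivAt (fun s => prodM X N s) (prodM X N t * vel X N t) t := by
  -- the two one-parameter factors
  have hc₂ : HasDerivAt (fun s : ℝ => (1 - s) ^ 2) (-2 * (1 - t)) t := by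
    have h1 : HasDerivAt (fun s : ℝ => 1 - s) (-1) t := by simpa using (hasDerivAt_id' t).const_sub (1:ℝ)
    have h := h1.mul h1
    simp only [← pow_two] at h
    refine h.congr_deriv ?_
    ring
  have hc₁ : HasDerivAt (fun s : ℝ => s - 1) 1 t := by simpa using (hasDerivAt_id' t).sub_const 1
  have hN := rvel_of_smul hc₂ N
  have hX := rvel_of_smul hc₁ X
  have hprod := hN.mul hX
  -- `E_N' E_X + E_N E_X' = E_N E_X (E_X⁻¹ (c₂'•N) E_X + X)`
  refine hprod.congr_deriv ?_
  show exp ((((1 - t) ^ 2 : ℝ) : ℂ) • N) * ((((-2 * (1 - t)) : ℝ) : ℂ) • N) * exp ((((t - 1) : ℝ) : ℂ) • X)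
      + exp ((((1 - t) ^ 2 : ℝ) : ℂ) • N) * (exp ((((t - 1) : ℝ) : ℂ) • X) * ((((1 : ℝ)) : ℂ) • X))
    = prodM X N t * vel X N t
  have hinv : exp ((((t - 1) : ℝ) : ℂ) • X) * exp ((((1 - t) : ℝ) : ℂ) • X) = 1 := expX_mul_exp_one_sub t X
  -- abbreviate the three exponentials
  set EN := exp ((((1 - t) ^ 2 : ℝ) : ℂ) • N) with hEN
  set EX := exp ((((t - 1) : ℝ) : ℂ) • X) with hEX
  set E1 := exp ((((1 - t) : ℝ) : ℂ) • X) with hE1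
  set c : ℂ := (((-2 * (1 - t)) : ℝ) : ℂ) with hc
  have hvel : vel X N t = X + c • (E1 * N * EX) := rfl
  have hP : prodM X N t = EN * EX := rfl
  rw [Complex.ofReal_one, one_smul, hvel, hP, mul_add, mul_smul_comm]
  have h3 : EN * EX * (E1 * N * EX) = EN * N * EX := by
    calc EN * EX * (E1 * N * EX) = EN * (EX * E1) * N * EX := by noncomm_ring
      _ = EN * N * EX := by rw [hinv, mul_one]
  rw [mul_smul_comm, h3, smul_mul_assoc, add_comm, mul_assoc EN EX X]

/-- The derivative of the conjugated normal part: `d∕dt C t = −(X·C t − C t·X)`. [folklore] -/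
theorem hasDerivAt_conjN (X N : Matrix n n ℂ) (t : ℝ) :
    HasDerivAt (fun s => conjN X N s) (-(X * conjN X N t - conjN X N t * X)) t := by
  have hc₁ : HasDerivAt (fun s : ℝ => 1 - s) (-1) t := by simpa using (hasDerivAt_id' t).const_sub 1
  have hc₂ : HasDerivAt (fun s : ℝ => s - 1) 1 t := by simpa using (hasDerivAt_id' t).sub_const 1
  have hL := rvel_of_smul hc₁ X
  have hR := rvel_of_smul hc₂ X
  have h := (hL.mul_const N).mul hR
  refine h.congr_deriv ?_
  simp only [conjN, Complex.ofReal_neg, Complex.ofReal_one, neg_smul, one_smul, mul_neg, neg_mul]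
  -- `exp(a) * (-X) * N * exp(b) + exp(a) * N * (exp(b) * X) = -(X * C - C * X)` using `exp(a) X = X exp(a)`
  have hcomm : exp ((((1 - t) : ℝ) : ℂ) • X) * X = X * exp ((((1 - t) : ℝ) : ℂ) • X) :=
    (Commute.exp_left ((Commute.refl X).smul_left _))
  rw [show exp ((((1 - t) : ℝ) : ℂ) • X) * X * N = X * (exp ((((1 - t) : ℝ) : ℂ) • X) * N) by rw [hcomm]; noncomm_ring]
  noncomm_ring

/-- **THE ACCELERATION FORMULA**: `d∕dt Ψ t = Ψ′ t` at every `t`. [folklore] -/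
theorem hasDerivAt_vel (X N : Matrix n n ℂ) (t : ℝ) :
    HasDerivAt (fun s => vel X N s) (acc X N t) t := by
  have hc : HasDerivAt (fun s : ℝ => -2 * (1 - s)) 2 t := by
    have h := ((hasDerivAt_id' t).const_sub 1).const_mul (-2 : ℝ)
    refine h.congr_deriv ?_; ring
  have hcC : HasDerivAt (fun s : ℝ => (((-2 * (1 - s)) : ℝ) : ℂ)) (((2 : ℝ) : ℂ)) t := hc.ofReal_comp
  have hC := hasDerivAt_conjN X N t
  have h := (hcC.smul hC).const_add X
  refine h.congr_deriv ?_
  have hs : -((((-2 * (1 - t)) : ℝ) : ℂ)) = (((2 * (1 - t)) : ℝ) : ℂ) := by push_cast; ring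
  rw [acc, smul_neg, ← neg_smul, hs, add_comm]

/-! ## §2 Skewness -/

/-- For skew `X`, `exp (c•X)` is unitary for every real `c`. [folklore] -/
theorem exp_real_smul_mem_unitary {X : Matrix n n ℂ} (hX : X ∈ skewAdjoint (Matrix n n ℂ)) (c : ℝ) :
    exp (((c : ℝ) : ℂ) • X) ∈ unitary (Matrix n n ℂ) := by
  letI : NormedAlgebra ℚ (Matrix n n ℂ) := NormedAlgebra.restrictScalars ℚ ℂ (Matrix n n ℂ)
  apply NormedSpace.exp_mem_unitary_of_mem_skewAdjoint
  have : (((c : ℝ) : ℂ) • X) = (c : ℝ) • X := by rw [Complex.coe_smul]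
  rw [this]
  exact skewAdjoint.smul_mem c hX

/-- `star (u N u⋆) = u (star N) u⋆`, hence conjugation by a unitary preserves skewness: `C t` is skew. [folklore] -/
theorem conjN_mem_skewAdjoint {X N : Matrix n n ℂ} (hX : X ∈ skewAdjoint (Matrix n n ℂ))
    (hN : N ∈ skewAdjoint (Matrix n n ℂ)) (t : ℝ) : conjN X N t ∈ skewAdjoint (Matrix n n ℂ) := by
  rw [skewAdjoint.mem_iff] at hX hN ⊢
  unfold conjN
  have h1 : star (exp ((((1 - t) : ℝ) : ℂ) • X)) = exp ((((t - 1) : ℝ) : ℂ) • X) := by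
    rw [star_exp, star_smul, hX, Complex.star_def, Complex.conj_ofReal, smul_neg, ← neg_smul]
    congr 1; push_cast; ring
  have h2 : star (exp ((((t - 1) : ℝ) : ℂ) • X)) = exp ((((1 - t) : ℝ) : ℂ) • X) := by
    rw [star_exp, star_smul, hX, Complex.star_def, Complex.conj_ofReal, smul_neg, ← neg_smul]
    congr 1; push_cast; ring
  rw [star_mul, star_mul, h1, h2, hN]
  noncomm_ring

/-- `Ψ t` is skew. [folklore] -/
theorem vel_mem_skewAdjoint {X N : Matrix n n ℂ} (hX : X ∈ skewAdjoint (Matrix n n ℂ))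
    (hN : N ∈ skewAdjoint (Matrix n n ℂ)) (t : ℝ) : vel X N t ∈ skewAdjoint (Matrix n n ℂ) := by
  unfold vel
  refine (skewAdjoint (Matrix n n ℂ)).add_mem hX ?_
  have : ((((-2 * (1 - t)) : ℝ) : ℂ) • conjN X N t) = ((-2 * (1 - t)) : ℝ) • conjN X N t := by rw [Complex.coe_smul]
  rw [this]
  exact skewAdjoint.smul_mem _ (conjN_mem_skewAdjoint hX hN t)

omit [DecidableEq n] in
/-- The commutator of two skew matrices is skew. [folklore] -/
theorem commutator_mem_skewAdjoint {A B : Matrix n n ℂ} (hA : A ∈ skewAdjoint (Matrix n n ℂ))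
    (hB : B ∈ skewAdjoint (Matrix n n ℂ)) : A * B - B * A ∈ skewAdjoint (Matrix n n ℂ) := by
  rw [skewAdjoint.mem_iff] at hA hB ⊢
  rw [star_sub, star_mul, star_mul, hA, hB]
  noncomm_ring

/-- `Ψ′ t` is skew. [folklore] -/
theorem acc_mem_skewAdjoint {X N : Matrix n n ℂ} (hX : X ∈ skewAdjoint (Matrix n n ℂ))
    (hN : N ∈ skewAdjoint (Matrix n n ℂ)) (t : ℝ) : acc X N t ∈ skewAdjoint (Matrix n n ℂ) := by
  unfold acc
  have hC := conjN_mem_skewAdjoint hX hN t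
  refine (skewAdjoint (Matrix n n ℂ)).add_mem ?_ ?_
  · have : (((2 : ℝ) : ℂ) • conjN X N t) = (2 : ℝ) • conjN X N t := by rw [Complex.coe_smul]
    rw [this]; exact skewAdjoint.smul_mem _ hC
  · have : ((((2 * (1 - t)) : ℝ) : ℂ) • (X * conjN X N t - conjN X N t * X))
        = ((2 * (1 - t)) : ℝ) • (X * conjN X N t - conjN X N t * X) := by rw [Complex.coe_smul]
    rw [this]; exact skewAdjoint.smul_mem _ (commutator_mem_skewAdjoint hX hC)

end

end Summit.QuantumFields.BalabanUV.T4Continuum.NE3ProductPath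

namespace Summit.QuantumFields.BalabanUV.T4Continuum.NE3ProductPath

open Set
open Literature.MathematicalPhysics.QuantumFieldTheory.Balaban1983to89
open B7Prop1Explicit B7Prop2Explicit MatrixLog
open T4AveragingDeficitWall (IsSkewDir vary)
open AveragingDeficitPeriodicCounting (IsPeriodicDir)
open NE3EnergyPathC2 (exp_neg_mul_exp_eq_one exp_mul_exp_neg_eq_one)
open NE3EnergyPathC2Velocity (rvel_of_smul)
open AveragingDeficitBlockDensity (norm_exp_sub_one_le_two_mul)

noncomputable section

variable {d : ℕ} {n : Type*} [Fintype n] [DecidableEq n]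

/-! ## §3 Log-coordinates of the product path -/

/-- The skew part `(A − A⋆)∕2`. [folklore] -/
def skewHalf (A : Matrix n n ℂ) : Matrix n n ℂ := ((1 / 2 : ℝ) : ℂ) • (A - star A)

omit [Fintype n] [DecidableEq n] in
/-- `skewHalf A` is skew. [folklore] -/
theorem skewHalf_mem (A : Matrix n n ℂ) : skewHalf A ∈ skewAdjoint (Matrix n n ℂ) := by
  rw [skewAdjoint.mem_iff, skewHalf, star_smul, star_sub, star_star, Complex.star_def, Complex.conj_ofReal,
    ← smul_neg, neg_sub]

omit [Fintype n] [DecidableEq n] in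
/-- On skew matrices `skewHalf` is the identity. [folklore] -/
theorem skewHalf_eq_self {A : Matrix n n ℂ} (hA : A ∈ skewAdjoint (Matrix n n ℂ)) : skewHalf A = A := by
  rw [skewAdjoint.mem_iff] at hA
  rw [skewHalf, hA, sub_neg_eq_add, ← two_smul ℂ A, smul_smul]
  norm_num

omit [Fintype n] [DecidableEq n] in
/-- `skewHalf 0 = 0`. [folklore] -/
@[simp] theorem skewHalf_zero : skewHalf (0 : Matrix n n ℂ) = 0 := by simp [skewHalf]

/-- **THE LOG-COORDINATES OF THE PRODUCT PATH** (a direction field, skew at EVERY time by construction):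
`Γ t x μ := skewHalf (mlog (P t))`, `P t = e^{(1−t)²N(x,μ)}·e^{(t−1)X(x,μ)}`. [folklore] -/
def pathΓ (X N : Site d → Fin d → Matrix n n ℂ) (t : ℝ) : Site d → Fin d → Matrix n n ℂ :=
  fun x μ => skewHalf (mlog (prodM (X x μ) (N x μ) t))

/-- `Γ t` is skew at every time. [folklore] -/
theorem isSkewDir_pathΓ (X N : Site d → Fin d → Matrix n n ℂ) (t : ℝ) : IsSkewDir (pathΓ X N t) :=
  fun _ _ => skewHalf_mem _

/-- `Γ 1 = 0`. [folklore] -/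
theorem pathΓ_one (X N : Site d → Fin d → Matrix n n ℂ) : pathΓ X N 1 = 0 := by
  funext x μ
  simp [pathΓ, prodM_one]

/-- `Γ t` is `P`-periodic when `X` and `N` are. [folklore] -/
theorem isPeriodicDir_pathΓ {X N : Site d → Fin d → Matrix n n ℂ} {P : ℤ} (hX : IsPeriodicDir X P) (hN : IsPeriodicDir N P)
    (t : ℝ) : IsPeriodicDir (pathΓ X N t) P := by
  intro x κ μ
  simp only [pathΓ, hX x κ μ, hN x κ μ]

/-- THE ELEMENTARY PRODUCT BOUND: `‖e^B·e^A − 1‖ ≤ ‖e^B − 1‖·‖e^A − 1‖ + ‖e^B − 1‖ + ‖e^A − 1‖`. [folklore] -/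
theorem norm_exp_mul_exp_sub_one_le (A B : Matrix n n ℂ) :
    ‖exp B * exp A - 1‖ ≤ ‖exp B - 1‖ * ‖exp A - 1‖ + ‖exp B - 1‖ + ‖exp A - 1‖ := by
  have h : exp B * exp A - 1 = (exp B - 1) * (exp A - 1) + (exp B - 1) + (exp A - 1) := by noncomm_ring
  rw [h]
  exact (norm_add_le _ _).trans (add_le_add ((norm_add_le _ _).trans (add_le_add (norm_mul_le _ _) le_rfl)) le_rfl)

/-- **THE PATH STAYS NEAR THE IDENTITY**: for `‖X‖ ≤ 1∕32`, `‖N‖ ≤ 1∕64` and `|1 − s| ≤ 3∕2`: `‖P s − 1‖ ≤ 1∕4`. [folklore] -/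
theorem norm_prodM_sub_one_le {X N : Matrix n n ℂ} (hX : ‖X‖ ≤ 1 / 32) (hN : ‖N‖ ≤ 1 / 64) {s : ℝ} (hs : |1 - s| ≤ 3 / 2) :
    ‖prodM X N s - 1‖ ≤ 1 / 4 := by
  have hA : ‖((((s - 1) : ℝ) : ℂ) • X)‖ ≤ 3 / 64 := by
    rw [norm_smul, Complex.norm_real, Real.norm_eq_abs, show s - 1 = -(1 - s) by ring, abs_neg]
    have := mul_le_mul hs hX (norm_nonneg _) (by norm_num)
    linarith
  have hB : ‖((((1 - s) ^ 2 : ℝ) : ℂ) • N)‖ ≤ 9 / 256 := by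
    rw [norm_smul, Complex.norm_real, Real.norm_eq_abs, abs_pow, ← sq_abs]
    have h1 : |1 - s| ^ 2 ≤ (3 / 2) ^ 2 := pow_le_pow_left₀ (abs_nonneg _) hs 2
    have := mul_le_mul h1 hN (norm_nonneg _) (by norm_num)
    simpa [abs_abs] using this.trans (by norm_num)
  have hu : ‖exp ((((s - 1) : ℝ) : ℂ) • X) - 1‖ ≤ 3 / 32 :=
    (norm_exp_sub_one_le_two_mul (hA.trans (by norm_num))).trans (by linarith)
  have hv : ‖exp ((((1 - s) ^ 2 : ℝ) : ℂ) • N) - 1‖ ≤ 9 / 128 :=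
    (norm_exp_sub_one_le_two_mul (hB.trans (by norm_num))).trans (by linarith)
  have h := norm_exp_mul_exp_sub_one_le ((((s - 1) : ℝ) : ℂ) • X) ((((1 - s) ^ 2 : ℝ) : ℂ) • N)
  have h0 : 0 ≤ ‖exp ((((s - 1) : ℝ) : ℂ) • X) - 1‖ := norm_nonneg _
  unfold prodM expN expX
  nlinarith

/-- The product is unitary when `X`, `N` are skew. [folklore] -/
theorem prodM_mem_unitary {X N : Matrix n n ℂ} (hX : X ∈ skewAdjoint (Matrix n n ℂ)) (hN : N ∈ skewAdjoint (Matrix n n ℂ))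
    (s : ℝ) : prodM X N s ∈ unitary (Matrix n n ℂ) :=
  Submonoid.mul_mem _ (exp_real_smul_mem_unitary hN _) (exp_real_smul_mem_unitary hX _)

/-- **`exp (Γ s) = P s` NEAR `[0,1]`**: for skew `X`, `N` with `‖X‖ ≤ 1∕32`, `‖N‖ ≤ 1∕64` and `|1 − s| ≤ 3∕2`, the logarithm of the
unitary `P s` (within `1∕4` of `1`) is skew (`B7Prop2Explicit.star_mlog_eq_neg`), so `skewHalf` does nothing and `exp ∘ mlog = id`. [folklore] -/
theorem exp_pathΓ {X N : Site d → Fin d → Matrix n n ℂ} (hXs : IsSkewDir X) (hNs : IsSkewDir N)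
    (hX : ∀ x μ, ‖X x μ‖ ≤ 1 / 32) (hN : ∀ x μ, ‖N x μ‖ ≤ 1 / 64) {s : ℝ} (hs : |1 - s| ≤ 3 / 2) (x : Site d) (μ : Fin d) :
    exp (pathΓ X N s x μ) = prodM (X x μ) (N x μ) s := by
  have h14 := norm_prodM_sub_one_le (hX x μ) (hN x μ) hs
  have hskew : mlog (prodM (X x μ) (N x μ) s) ∈ skewAdjoint (Matrix n n ℂ) := by
    rw [skewAdjoint.mem_iff]
    exact ExpMeanLog.star_mlog_eq_neg (prodM_mem_unitary (hXs x μ) (hNs x μ) s) (h14.trans (by norm_num))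
  have h1 : ‖prodM (X x μ) (N x μ) s - 1‖ < 1 := lt_of_le_of_lt h14 (by norm_num)
  show exp (skewHalf (mlog (prodM (X x μ) (N x μ) s))) = _
  rw [skewHalf_eq_self hskew]
  exact exp_mlog h1

/-- On `[0,1]` itself: `exp (Γ t) = P t`. [folklore] -/
theorem exp_pathΓ_of_mem {X N : Site d → Fin d → Matrix n n ℂ} (hXs : IsSkewDir X) (hNs : IsSkewDir N)
    (hX : ∀ x μ, ‖X x μ‖ ≤ 1 / 32) (hN : ∀ x μ, ‖N x μ‖ ≤ 1 / 64) {t : ℝ} (ht : t ∈ Icc (0:ℝ) 1) (x : Site d) (μ : Fin d) :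
    exp (pathΓ X N t x μ) = prodM (X x μ) (N x μ) t :=
  exp_pathΓ hXs hNs hX hN (by rw [abs_le]; constructor <;> linarith [ht.1, ht.2]) x μ

/-- The moving configuration IS `W·P t`: `(vary W (Γ t) 1)(x,μ) = W(x,μ)·e^{(1−t)²N}·e^{(t−1)X}` on `[0,1]`. [folklore] -/
theorem val_vary_pathΓ {X N : Site d → Fin d → Matrix n n ℂ} (hXs : IsSkewDir X) (hNs : IsSkewDir N)
    (hX : ∀ x μ, ‖X x μ‖ ≤ 1 / 32) (hN : ∀ x μ, ‖N x μ‖ ≤ 1 / 64) {t : ℝ} (ht : t ∈ Icc (0:ℝ) 1)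
    (W : Site d → Fin d → (Matrix n n ℂ)ˣ) (x : Site d) (μ : Fin d) :
    ((vary W (pathΓ X N t) 1 x μ : (Matrix n n ℂ)ˣ) : Matrix n n ℂ) = (W x μ : Matrix n n ℂ) * prodM (X x μ) (N x μ) t := by
  simp only [vary, Units.val_mul, val_expUnit, Complex.ofReal_one, one_smul, exp_pathΓ_of_mem hXs hNs hX hN ht]

/-- **THE VELOCITY FIELD OF THE CHART**: on `[0,1]`, `s ↦ exp (Γ s (x,μ))` has right-logarithmic velocity `Ψ t (x,μ) = vel …`
(eventual equality with the product path near `t`, then `hasDerivAt_prodM`). [folklore] -/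
theorem hasDerivAt_exp_pathΓ {X N : Site d → Fin d → Matrix n n ℂ} (hXs : IsSkewDir X) (hNs : IsSkewDir N)
    (hX : ∀ x μ, ‖X x μ‖ ≤ 1 / 32) (hN : ∀ x μ, ‖N x μ‖ ≤ 1 / 64) {t : ℝ} (ht : t ∈ Icc (0:ℝ) 1) (x : Site d) (μ : Fin d) :
    HasDerivAt (fun s => exp (pathΓ X N s x μ)) (exp (pathΓ X N t x μ) * vel (X x μ) (N x μ) t) t := by
  have hEq : (fun s => exp (pathΓ X N s x μ)) =ᶠ[𝓝 t] fun s => prodM (X x μ) (N x μ) s := by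
    have hmem : Ioo (t - 1 / 2) (t + 1 / 2) ∈ 𝓝 t := Ioo_mem_nhds (by linarith) (by linarith)
    filter_upwards [hmem] with s hs
    have hs' : |1 - s| ≤ 3 / 2 := by
      rw [abs_le]; constructor <;> linarith [hs.1, hs.2, ht.1, ht.2]
    exact exp_pathΓ hXs hNs hX hN hs' x μ
  rw [exp_pathΓ_of_mem hXs hNs hX hN ht]
  exact (hasDerivAt_prodM (X x μ) (N x μ) t).congr_of_eventuallyEq hEq

/-- THE REPRESENTATION AT `t = 0`: `W·P 0 = W·e^{N}·e^{−X}`, so a pair with `U_A^u(b) = W(b)·e^{N(b)}·e^{−X(b)}` bondwise has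
`gaugeAct u U_A = vary W (Γ 0) 1`. [folklore] -/
theorem eq_vary_pathΓ_zero {X N : Site d → Fin d → Matrix n n ℂ} (hXs : IsSkewDir X) (hNs : IsSkewDir N)
    (hX : ∀ x μ, ‖X x μ‖ ≤ 1 / 32) (hN : ∀ x μ, ‖N x μ‖ ≤ 1 / 64)
    (W U : Site d → Fin d → (Matrix n n ℂ)ˣ)
    (hU : ∀ x μ, ((U x μ : (Matrix n n ℂ)ˣ) : Matrix n n ℂ) = (W x μ : Matrix n n ℂ) * (exp (N x μ) * exp (-X x μ))) :
    U = vary W (pathΓ X N 0) 1 := by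
  funext x μ
  ext
  rw [val_vary_pathΓ hXs hNs hX hN ⟨le_rfl, zero_le_one⟩, prodM_zero, hU]

end

end Summit.QuantumFields.BalabanUV.T4Continuum.NE3ProductPath
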